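import Summits.HodgeConjecture.HodgeConjecture.Theorems.F0P2oLineJacquetFrameTransport          -- ★ B-p14 (g29) (C6): `lineJacquet_transport` (+ ★ p837171 `…FrameTransportOfRecord`, ★ p835111 letter-(a) tokens)
import Mathlib.LinearAlgebra.Matrix.Permutation                                                  -- `Equiv.Perm.permMatrix`, `Matrix.permMatrix_mul`, `Matrix.transpose_permMatrix`
import HarnessLib

/-!
# Crux `H413` — N3 ROAD (a), row (J4): the line-Jacquet intertwiner (N′) REINDEXES — from one pair enumeration `e₁′ : Fin 3 × Fin 1 ≃ Fin n′` to any other `e₁`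

F0∕P2, cell `hodgecm-mathlib`, crux item `stmt-HodgeConjecture-24833`; A-p01 (g19) on the K1∕N3 lead B-p18 (g29)'s dealing 2026-08-31T23:47:37Z (2) (binder shape: B-p14 (g29)
23:55:00Z — general `n′`, two enumerations).  PROOF lane (theorems only; no `def`, no instance, no notation, no `sorry`); `--supports stmt-HodgeConjecture-24833 --as helper`.
HONEST LABEL: HC_CM is proved only modulo the printed citations until rung 0 closes; this file proves NO letter — it is plumbing for the closer of N3 #96 (a):
the letter ★ `thetaType_nonsplit_jacquetModule_of_lineJacquet` ∕ F0P2-p06 (g4)'s `hL` quantify `∀ {n′} (e₁ : Fin 3 × Fin 1 ≃ Fin n′)`, while (C5) (B-p10 (g23)) produces (N′)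
at the standard enumeration `e_std := Equiv.prodUnique (Fin 3) (Fin 1)` only.

THE MATHEMATICS (one paragraph).  Two enumerations `e, e′ : Fin N × Fin 1 ≃ Fin n` of the pair basis differ by the permutation `σ := e⁻¹ ∘ e′ ∈ 𝔖_n`, and the
PERMUTATION FRAME `P_σ ∈ GL_n(F)` (`↑P_σ = σ.permMatrix`, a rational frame with `P_σᵀ = P_σ⁻¹`) satisfies `P_σᵀ · gram e T_V T_W · P_σ = gram e′ T_V T_W` (§1,
`transpose_permFrame_mul_gram_mul_permFrame`) and CONJUGATES THE FIRST MEMBER OF THE DUAL PAIR ONTO ITSELF: `P_σ · reindex e′ (k ⊗ 1) · P_σ⁻¹ = reindex e (k ⊗ 1)` for every `k ∈ U(J_V)(F_w)`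
(§2, `frameConj_permFrame_localLineInl` — the chart `ch_T` followed by `localLineInl e′` IS `frameConj_{P_σ}`-conjugate to the chart followed by `localLineInl e`, with the SAME `k`).
Hence (FN) (U) ★ `frameOp_toRep_localSplittingCMWith` (B-p08 (g24): the metaplectic frame operator `frameOp_{P_σ} : 𝒮(F_vⁿ) ≃ 𝒮(F_vⁿ)` intertwines ★ `localSplittingCM` at the Grams `gram e …` and
`gram e′ … = P_σᵀ (gram e …) P_σ`, both diagonal by ★ `gram_diagonal_TW`), read through the bridge ★ `chiLocalSplittingsCM_s_eq_localSplittingCM` (A-p01 (g19), p837171), makes `frameOp_{P_σ}` a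
`U(Φ₃)(L⁺_v)`-INTERTWINER between the local Weil representations of record `Ω_{dV,T,e′}` and `Ω_{dV,T,e}` read through the common chart (§3, `frameOp_omegaLoc_chiLocalSplittingsCM_perm`);
the line model `ω¹ = lineWeilCM L e₀ (kernelLineCM dV) …` does not see the pair enumeration (`Φ₁ := id`), and B-p14 (g29)'s generic ★ `lineJacquet_transport` ([BernsteinZelevinsky1976, §2.30]:
`r_N` is a functor) carries the (N′)-shaped intertwiner across (§4, HEAD `lineJacquet_reindex`; corollary `lineJacquet_reindex_std` from `e_std`, doing the `n′ = 3` substitution once).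

References: [MoeglinVignerasWaldspurger1987] Chap. 2 II Remarque (3) (the Weil representation and its lattice model do not depend on the chosen basis up to the frame operator);
[GelbartRogawski1991] §3.1 p. 454–455, §3.2 p. 457; [BernsteinZelevinsky1976] §2.30; [Kudla1994] §3 Thm. 3.1; [PlatonovRapinchuk1994] §2.3.
-/

set_option autoImplicit false
-- the mandated namespace repeats `HodgeConjecture.HodgeConjecture`, as in every `Theorems/*.lean` of this sub-problem
set_option linter.dupNamespace false

noncomputable section

open NumberField IsDedekindDomain Matrix MeasureTheory
open scoped MatrixGroups Kronecker
open Literature.NumberTheory.Automorphic Literature.NumberTheory.Automorphic.UnitaryGroup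
open Literature.NumberTheory.GelbartRogawski1991 Literature.NumberTheory.GelbartRogawski1991.UnitaryDualPair
open Literature.NumberTheory.GelbartRogawski1991.UnitaryDualPair.LocalSplitting Literature.NumberTheory.GelbartRogawski1991.UnitaryDualPair.WeilCoinv
open Literature.NumberTheory.GelbartRogawski1991.GRConstruction
open Literature.NumberTheory.Automorphic.IdeleClassGroup
open Literature.NumberTheory.Automorphic.Liu2021 Literature.NumberTheory.Automorphic.Liu2021.Def411WeilCarriers
open Literature.NumberTheory.Automorphic.Liu2021.Def411WeilCarriersDoubling
open Literature.RepresentationTheory Literature.RepresentationTheory.HeisenbergGroup Literature.RepresentationTheory.Liu2021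
open Literature.NumberTheory.GaloisRepresentations Literature.RepresentationTheory.HarrisKudlaSweet1996
open Literature.NumberTheory.Rogawski1990

namespace Summit.HodgeConjecture.HodgeConjecture.Cruxes.H413.F0P2oLineJacquetReindex

open Summit.HodgeConjecture.HodgeConjecture.Cruxes.H413.F0P2oLineWeilDictionaryFrameTransport
open Summit.HodgeConjecture.HodgeConjecture.Cruxes.H413.F0P2oLineWeilDictionaryFrameTransportOfRecord
open Summit.HodgeConjecture.HodgeConjecture.Cruxes.H413.F0P2oLineJacquetFrameTransport

/-! ## §1 The permutation frame `P_σ` (`↑P_σ = σ.permMatrix`): conjugation is `submatrix σ σ`; `P_σᵀ · gram e · P_σ = gram e′` for `σ = e⁻¹ e′` -/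

section PermFrame

variable {R : Type*} [CommRing R] {n : ℕ}

/-- `σ.permMatrix · M · σ⁻¹.permMatrix = M.submatrix σ σ` (rows and columns renamed by `σ`). [cite: PlatonovRapinchuk1994, §2.3] -/
theorem permMatrix_mul_mul_permMatrix_inv (σ : Equiv.Perm (Fin n)) (M : Matrix (Fin n) (Fin n) R) :
    Equiv.Perm.permMatrix R σ * M * Equiv.Perm.permMatrix R σ⁻¹ = M.submatrix σ σ := by
  rw [Equiv.Perm.permMatrix, Equiv.Perm.permMatrix, PEquiv.toMatrix_toPEquiv_mul, PEquiv.mul_toMatrix_toPEquiv,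
    Matrix.submatrix_submatrix, Function.comp_id, Function.id_comp, Equiv.Perm.inv_def, Equiv.symm_symm]

/-- `σ⁻¹.permMatrix · M · σ.permMatrix = M.submatrix σ⁻¹ σ⁻¹`. [cite: PlatonovRapinchuk1994, §2.3] -/
theorem permMatrix_inv_mul_mul_permMatrix (σ : Equiv.Perm (Fin n)) (M : Matrix (Fin n) (Fin n) R) :
    Equiv.Perm.permMatrix R σ⁻¹ * M * Equiv.Perm.permMatrix R σ = M.submatrix σ.symm σ.symm := by
  rw [← Equiv.Perm.inv_def, ← permMatrix_mul_mul_permMatrix_inv σ⁻¹ M, inv_inv]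

/-- **the permutation frame exists in `GL_n(R)`**: `σ.permMatrix` is invertible with inverse `σ⁻¹.permMatrix`. [cite: PlatonovRapinchuk1994, §2.3] -/
theorem exists_GL_coe_eq_permMatrix (σ : Equiv.Perm (Fin n)) :
    ∃ P : GL (Fin n) R, (P : Matrix (Fin n) (Fin n) R) = Equiv.Perm.permMatrix R σ :=
  ⟨⟨Equiv.Perm.permMatrix R σ, Equiv.Perm.permMatrix R σ⁻¹, by rw [← Matrix.permMatrix_mul, inv_mul_cancel, Matrix.permMatrix_one],
    by rw [← Matrix.permMatrix_mul, mul_inv_cancel, Matrix.permMatrix_one]⟩, rfl⟩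

/-- the inverse of a permutation frame: `↑P⁻¹ = σ⁻¹.permMatrix`. [cite: PlatonovRapinchuk1994, §2.3] -/
theorem coe_inv_of_coe_eq_permMatrix (σ : Equiv.Perm (Fin n)) (P : GL (Fin n) R) (hP : (P : Matrix (Fin n) (Fin n) R) = Equiv.Perm.permMatrix R σ) :
    ((P⁻¹ : GL (Fin n) R) : Matrix (Fin n) (Fin n) R) = Equiv.Perm.permMatrix R σ⁻¹ :=
  Units.inv_eq_of_mul_eq_one_right (by rw [hP, ← Matrix.permMatrix_mul, inv_mul_cancel, Matrix.permMatrix_one])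

variable {F : Type} [Field F] {N M : ℕ} (e e' : Fin N × Fin M ≃ Fin n) (TV : Matrix (Fin N) (Fin N) F) (TW : Matrix (Fin M) (Fin M) F)

/-- **THE PERMUTATION FRAME BETWEEN TWO PAIR ENUMERATIONS**: `P_σᵀ · gram e T_V T_W · P_σ = gram e′ T_V T_W` for `↑P_σ = (e⁻¹ e′).permMatrix`
(`P_σᵀ = P_{σ⁻¹}`; ★ `gram e T_V T_W = reindex e e (T_V ⊗ T_W)`). [cite: GelbartRogawski1991, §3.1 p. 454] [cite: PlatonovRapinchuk1994, §2.3] -/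
theorem transpose_permFrame_mul_gram_mul_permFrame (P : GL (Fin n) F) (hP : (P : Matrix (Fin n) (Fin n) F) = Equiv.Perm.permMatrix F (e.symm.trans e')) :
    (P : Matrix (Fin n) (Fin n) F)ᵀ * UnitaryDualPair.gram F e TV TW * (P : Matrix (Fin n) (Fin n) F) = UnitaryDualPair.gram F e' TV TW := by
  rw [hP, Matrix.transpose_permMatrix, permMatrix_inv_mul_mul_permMatrix, UnitaryDualPair.gram, UnitaryDualPair.gram, Matrix.reindex_apply,
    Matrix.reindex_apply, Matrix.submatrix_submatrix]
  congr 1 <;> ext i <;> simp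

end PermFrame

/-! ## §2 The chart is permutation-equivariant: `frameConj_{P_σ} ∘ localLineInl e′ = localLineInl e` (same `k`) -/

section Chart

variable {F : Type} [Field F] [NumberField F] (E : Type) [Field E] [NumberField E] [Algebra F E] (c : E ≃ₐ[F] E)
  (N : ℕ) {n : ℕ} (e e' : Fin N × Fin 1 ≃ Fin n) (w : HeightOneSpectrum (𝓞 F))
  {T : Matrix (Fin N) (Fin N) F} {J : Matrix (Fin N) (Fin N) E} (hJ : J = T.map (algebraMap F E))
  (TW : Matrix (Fin 1) (Fin 1) F) {JW : Matrix (Fin 1) (Fin 1) E} (hJW : JW = TW.map (algebraMap F E))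
  (P : GL (Fin n) F) (hP : (P : Matrix (Fin n) (Fin n) F) = Equiv.Perm.permMatrix F (e.symm.trans e'))

/-- **the permutation frame read locally is the permutation matrix**: the `𝔴`-component of `framePloc P_σ ∈ GL_n(E ⊗ F_w)` is `σ.permMatrix ∈ GL_n(E_𝔴)`.
[cite: PlatonovRapinchuk1994, §2.3] -/
theorem coe_localGLPiEquiv_framePloc (σ : Equiv.Perm (Fin n)) (Q : GL (Fin n) F) (hQ : (Q : Matrix (Fin n) (Fin n) F) = Equiv.Perm.permMatrix F σ)
    (𝔴 : PlacesOver E w) :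
    ((localGLPiEquiv E n w (FrameTransport.framePloc F E w n Q) 𝔴 : GL (Fin n) (𝔴.1.adicCompletion E)) : Matrix (Fin n) (Fin n) (𝔴.1.adicCompletion E)) =
      Equiv.Perm.permMatrix (𝔴.1.adicCompletion E) σ := by
  ext i j
  rw [GLn.coe_piEquiv_apply, Matrix.map_apply, FrameTransport.coe_framePloc, Matrix.map_apply, hQ, Equiv.Perm.permMatrix, Equiv.Perm.permMatrix,
    PEquiv.toMatrix_apply, PEquiv.toMatrix_apply]
  split_ifs <;> simp

/-- `framePloc (P⁻¹) = (framePloc P)⁻¹` (definitional: `framePloc` is `Units.map`). [cite: PlatonovRapinchuk1994, §2.3] -/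
theorem framePloc_inv (Q : GL (Fin n) F) : FrameTransport.framePloc F E w n Q⁻¹ = (FrameTransport.framePloc F E w n Q)⁻¹ := rfl

include hP in
/-- **THE CHART IS PERMUTATION-EQUIVARIANT**: `frameConj_{P_σ} (localLineInl e′ k) = localLineInl e k` for the permutation frame `↑P_σ = (e⁻¹ e′).permMatrix` and every
`k ∈ U(J_V)(F_w)` — place by place `P_σ · reindex e′ (k_𝔴 ⊗ 1) · P_σ⁻¹ = (reindex e′ (k_𝔴 ⊗ 1)).submatrix σ σ = reindex e (k_𝔴 ⊗ 1)` (★ `coe_frameConj`, ★ `coe_localLineGL_apply`).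
[cite: MoeglinVignerasWaldspurger1987, Chap. 1 I.17; Chap. 2 II Remarque (3)] [cite: GelbartRogawski1991, §3.2 p. 457] -/
theorem frameConj_permFrame_localLineInl (k : localPi E c N J w) :
    FrameTransport.frameConj F E c w n (reindex_kronecker_eq_gram_map F E e hJ hJW) (reindex_kronecker_eq_gram_map F E e' hJ hJW) P
        (transpose_permFrame_mul_gram_mul_permFrame e e' T TW P hP) (localLineInl E c N e' J JW w k) =
      localLineInl E c N e J JW w k := by
  refine Subtype.ext (funext fun 𝔴 => Units.ext ?_)
  rw [coe_frameConj, coe_localLineInl, coe_localLineInl, Pi.mul_apply, Pi.mul_apply, ← map_inv, ← framePloc_inv, Units.val_mul, Units.val_mul,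
    coe_localGLPiEquiv_framePloc E w _ P hP, coe_localGLPiEquiv_framePloc E w _ P⁻¹ (coe_inv_of_coe_eq_permMatrix _ P hP), coe_localLineGL_apply,
    coe_localLineGL_apply, permMatrix_mul_mul_permMatrix_inv, Matrix.reindex_apply, Matrix.reindex_apply, Matrix.submatrix_submatrix]
  congr 1 <;> ext i <;> simp

end Chart

/-! ## §3 The pair side for the CM packages of record: `frameOp_{P_σ}` intertwines `Ω_{dV,e′}` with `Ω_{dV,e}` along `frameConj_{P_σ}` -/

section PairSide

variable (L : Type) [Field L] [NumberField L] [IsCMField L] (v : HeightOneSpectrum (𝓞 ↥(maximalRealSubfield L)))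
  (dV : Fin 3 → L) (hdV : ∀ i, IsCMField.complexConj L (dV i) = dV i) {n' : ℕ} (e e' : Fin 3 × Fin 1 ≃ Fin n') (hdV0 : ∀ i, dV i ≠ 0) (ε : (↥(maximalRealSubfield L))ˣ)
  (P : GL (Fin n') ↥(maximalRealSubfield L)) (hP : (P : Matrix (Fin n') (Fin n') ↥(maximalRealSubfield L)) = Equiv.Perm.permMatrix (↥(maximalRealSubfield L)) (e.symm.trans e'))
  (θ : HeckeCharacter L) (hθ : IsSplittingChar L 1 θ)

/-- `0 < m` for `Fin 3 × Fin 1 ≃ Fin m`. [folklore] -/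
private theorem pos_of_equiv {m : ℕ} (e₁ : Fin 3 × Fin 1 ≃ Fin m) : 0 < m := Fin.pos (e₁ (0, 0))

set_option synthInstance.maxHeartbeats 400000 in
set_option maxHeartbeats 4000000 in
/-- **THE LOCAL WEIL REPRESENTATIONS OF RECORD AT TWO PAIR ENUMERATIONS ARE `frameOp_{P_σ}`-INTERTWINED** along `frameConj_{P_σ}`: (FN) (U) ★ `frameOp_toRep_localSplittingCMWith`
(B-p08 (g24)) at the Grams `T₀ := gram e (realDiagonal dV) (TW ε)`, `T₀′ := gram e′ … = P_σᵀ T₀ P_σ` (§1; `T₀′` diagonal by ★ `gram_diagonal_TW`), Borel σ-algebra and Mathlib's `addHaar`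
(the Haar data inside ★ `localSplittingCM`), read through the bridge ★ `chiLocalSplittingsCM_s_eq_localSplittingCM` at `e` and at `e′`.
[cite: MoeglinVignerasWaldspurger1987, Chap. 2 II Remarque (3)] [cite: Kudla1994, §3 Thm 3.1] [cite: GelbartRogawski1991, §3.1 Prop. 3.1.1 p. 455] -/
theorem frameOp_omegaLoc_chiLocalSplittingsCM_perm
    (g' : localPi L (IsCMField.complexConj L) n' (Matrix.reindex e' e' (Matrix.diagonal dV ⊗ₖ JW (↥(maximalRealSubfield L)) L ε)) v)
    (f : SchwartzBruhat (Fin n' → v.adicCompletion (↥(maximalRealSubfield L)))) :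
    FrameTransport.frameOp (↥(maximalRealSubfield L)) v n' P
        (MpPsi.toRep (localSchrodinger (↥(maximalRealSubfield L)) n' (UnitaryDualPair.gram (↥(maximalRealSubfield L)) e' (realDiagonal L dV hdV) (TW (↥(maximalRealSubfield L)) ε)) v)
          ((chiLocalSplittingsCM L e' dV hdV hdV0 θ hθ ε).s v g') f) =
      MpPsi.toRep (localSchrodinger (↥(maximalRealSubfield L)) n' (UnitaryDualPair.gram (↥(maximalRealSubfield L)) e (realDiagonal L dV hdV) (TW (↥(maximalRealSubfield L)) ε)) v)
        ((chiLocalSplittingsCM L e dV hdV hdV0 θ hθ ε).s v (FrameTransport.frameConj (↥(maximalRealSubfield L)) L (IsCMField.complexConj L) v n'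
          (reindex_kronecker_eq_gram_map (↥(maximalRealSubfield L)) L e (realDiagonal_map L dV hdV).symm (JW_eq (↥(maximalRealSubfield L)) L ε))
          (reindex_kronecker_eq_gram_map (↥(maximalRealSubfield L)) L e' (realDiagonal_map L dV hdV).symm (JW_eq (↥(maximalRealSubfield L)) L ε))
          P (transpose_permFrame_mul_gram_mul_permFrame e e' (realDiagonal L dV hdV) (TW (↥(maximalRealSubfield L)) ε) P hP) g'))
        (FrameTransport.frameOp (↥(maximalRealSubfield L)) v n' P f) := by
  rw [chiLocalSplittingsCM_s_eq_localSplittingCM, chiLocalSplittingsCM_s_eq_localSplittingCM]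
  letI : MeasurableSpace (v.adicCompletion ↥(maximalRealSubfield L)) := borel _
  haveI : BorelSpace (v.adicCompletion ↥(maximalRealSubfield L)) := ⟨rfl⟩
  have hU := frameOp_toRep_localSplittingCMWith L v MeasureTheory.Measure.addHaar n' (pos_of_equiv e')
    (fun i => (realDiagonal L dV hdV) (e'.symm i).1 (e'.symm i).1 * ((ε : (↥(maximalRealSubfield L))ˣ) : ↥(maximalRealSubfield L)))
    (by unfold realDiagonal; rw [gram_diagonal_TW]; simp only [Matrix.diagonal_apply_eq])
    (isSymm_gram (↥(maximalRealSubfield L)) e (realDiagonal_isSymm L dV hdV) (isSymm_TW (↥(maximalRealSubfield L)) ε))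
    (isUnit_det_gram (↥(maximalRealSubfield L)) e (isUnit_det_realDiagonal L dV hdV hdV0) (isUnit_det_TW (↥(maximalRealSubfield L)) ε))
    (isSymm_gram (↥(maximalRealSubfield L)) e' (realDiagonal_isSymm L dV hdV) (isSymm_TW (↥(maximalRealSubfield L)) ε))
    (isUnit_det_gram (↥(maximalRealSubfield L)) e' (isUnit_det_realDiagonal L dV hdV hdV0) (isUnit_det_TW (↥(maximalRealSubfield L)) ε))
    P (transpose_permFrame_mul_gram_mul_permFrame e e' (realDiagonal L dV hdV) (TW (↥(maximalRealSubfield L)) ε) P hP)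
    (reindex_kronecker_eq_gram_map (↥(maximalRealSubfield L)) L e (realDiagonal_map L dV hdV).symm (JW_eq (↥(maximalRealSubfield L)) L ε))
    (reindex_kronecker_eq_gram_map (↥(maximalRealSubfield L)) L e' (realDiagonal_map L dV hdV).symm (JW_eq (↥(maximalRealSubfield L)) L ε)) θ hθ g' f
  simp only [MonoidHom.comp_apply] at hU
  exact hU

end PairSide

/-! ## §4 HEAD: (N′) reindexes along the pair enumeration -/

section Head

variable (L : Type) [Field L] [NumberField L] [IsCMField L] (v : HeightOneSpectrum (𝓞 ↥(maximalRealSubfield L)))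
  (dV : Fin 3 → L) (hdV : ∀ i, IsCMField.complexConj L (dV i) = dV i) (hdV0 : ∀ i, dV i ≠ 0) (ε : (↥(maximalRealSubfield L))ˣ)

set_option synthInstance.maxHeartbeats 400000 in
set_option maxHeartbeats 8000000 in
/-- **(J4) THE LINE-JACQUET INTERTWINER (N′) REINDEXES ALONG THE PAIR ENUMERATION.**  For any two enumerations `e₁, e₁′ : Fin 3 × Fin 1 ≃ Fin n′` of the pair basis:
if the local Weil representation of record at `(dV, ε)` built on the enumeration `e₁′`, read on `U(Φ₃)(L⁺_v)` through the chart `ch_T` and `localLineInl e₁′`, admits a line-Jacquet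
intertwiner (F0P2-p06 (g4)'s `hTr` binder at `(dV, T, e₁′)`, token for token), then so does the one built on `e₁` (the same binder at `(dV, T, e₁)`).  `Tr := Tr′ ∘ r_N(frameOp_{P_σ})`
for the permutation frame `↑P_σ = (e₁′⁻¹ e₁).permMatrix` (§1 `exists_GL_coe_eq_permMatrix`): B-p14 (g29)'s ★ `lineJacquet_transport` at the pair-side intertwiner §3
`frameOp_omegaLoc_chiLocalSplittingsCM_perm` composed with §2 `frameConj_permFrame_localLineInl` (`frameConj_{P_σ} ∘ localLineInl e₁ = localLineInl e₁′`, same chart `ch_T`), line side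
the identity (`ω¹ = lineWeilCM L e₀ (kernelLineCM dV) …` does not see `e₁`); the torus clause `diag(1, det u, 1) = t` lives in `U(Φ₃)(L⁺_v)` and is not moved.
[cite: BernsteinZelevinsky1976, §2.30] [cite: MoeglinVignerasWaldspurger1987, Chap. 2 II Remarque (3)] [cite: GelbartRogawski1991, §3.2 (3.2.1)–(3.2.2) p. 457] -/
theorem lineJacquet_reindex {n' : ℕ} (e₁ e₁' : Fin 3 × Fin 1 ≃ Fin n') {n₀ : ℕ} (e₀ : Fin 1 × Fin 1 ≃ Fin n₀)
    (μ : Literature.NumberTheory.Automorphic.IdeleClassGroup L →ₜ* Circle) (hμ : IsConjugateSymplectic L μ)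
    (T : GL (Fin 3) (LocalRing L v)) {a : LocalRing L v} (ha : IsUnit a)
    (h : formCongr (conjLocal L (IsCMField.complexConj L) v) T ((Matrix.diagonal dV).map (algebraMap L (LocalRing L v))) =
      a • (Matrix.of fun i j : Fin 3 => if i.val + j.val + 1 = 3 then (1 : L) else 0).map (algebraMap L (LocalRing L v)))
    (hN' : ∃ Tr' : ((cmBorelTriple L 3 v).restrict
      (((chiLocalSplittingsCM L e₁' dV hdV hdV0 (toHeckeCharacter L μ) ((isOscillatorChar_toHeckeCharacter_iff μ).mpr hμ) ε).omegaLoc v).comp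
        ((localLineInl L (IsCMField.complexConj L) 3 e₁' (Matrix.diagonal dV) (JW (↥(maximalRealSubfield L)) L ε) v).comp
          ((localPiEquiv L (IsCMField.complexConj L) 3 (Matrix.diagonal dV) v).symm.toMonoidHom.comp
            (cmDatumLocalCongr L v T ha h).toMonoidHom)))).Coinvariants ≃ₗ[ℂ]
      SchwartzBruhat (Fin n₀ → v.adicCompletion ↥(maximalRealSubfield L)),
      ∀ (u : localPi L (IsCMField.complexConj L) 1 (JW (↥(maximalRealSubfield L)) L ε) v) (t : ↥(cmBorelTriple L 3 v).M),
        glDiagonal 3 (LocalRing L v) ![1, ((localDet (IsCMField.complexConj L) v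
          (isUnit_iff_ne_zero.mpr (by rw [Matrix.det_fin_one]; exact JW_apply_ne_zero (↥(maximalRealSubfield L)) L ε))
          (localPiEquiv L (IsCMField.complexConj L) 1 (JW (↥(maximalRealSubfield L)) L ε) v u) :
            ↥(normOneUnits (conjLocal L (IsCMField.complexConj L) v))) : (LocalRing L v)ˣ), 1] =
          ((t : ↥(unitaryGroupOfForm (conjLocal L (IsCMField.complexConj L) v) (cmLocalForm L 3 v))) : GL (Fin 3) (LocalRing L v)) →
        ∀ x, Tr' (Representation.jacquetModule
          (((chiLocalSplittingsCM L e₁' dV hdV hdV0 (toHeckeCharacter L μ) ((isOscillatorChar_toHeckeCharacter_iff μ).mpr hμ) ε).omegaLoc v).comp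
            ((localLineInl L (IsCMField.complexConj L) 3 e₁' (Matrix.diagonal dV) (JW (↥(maximalRealSubfield L)) L ε) v).comp
              ((localPiEquiv L (IsCMField.complexConj L) 3 (Matrix.diagonal dV) v).symm.toMonoidHom.comp
                (cmDatumLocalCongr L v T ha h).toMonoidHom)))
          (cmBorelTriple L 3 v) t x) =
          lineWeilCM L e₀ (kernelLineCM dV) (complexConj_kernelLineCM dV hdV) (kernelLineCM_ne_zero dV hdV0) μ hμ ε v u (Tr' x)) :
    ∃ Tr : ((cmBorelTriple L 3 v).restrict
      (((chiLocalSplittingsCM L e₁ dV hdV hdV0 (toHeckeCharacter L μ) ((isOscillatorChar_toHeckeCharacter_iff μ).mpr hμ) ε).omegaLoc v).comp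
        ((localLineInl L (IsCMField.complexConj L) 3 e₁ (Matrix.diagonal dV) (JW (↥(maximalRealSubfield L)) L ε) v).comp
          ((localPiEquiv L (IsCMField.complexConj L) 3 (Matrix.diagonal dV) v).symm.toMonoidHom.comp
            (cmDatumLocalCongr L v T ha h).toMonoidHom)))).Coinvariants ≃ₗ[ℂ]
      SchwartzBruhat (Fin n₀ → v.adicCompletion ↥(maximalRealSubfield L)),
      ∀ (u : localPi L (IsCMField.complexConj L) 1 (JW (↥(maximalRealSubfield L)) L ε) v) (t : ↥(cmBorelTriple L 3 v).M),
        glDiagonal 3 (LocalRing L v) ![1, ((localDet (IsCMField.complexConj L) v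
          (isUnit_iff_ne_zero.mpr (by rw [Matrix.det_fin_one]; exact JW_apply_ne_zero (↥(maximalRealSubfield L)) L ε))
          (localPiEquiv L (IsCMField.complexConj L) 1 (JW (↥(maximalRealSubfield L)) L ε) v u) :
            ↥(normOneUnits (conjLocal L (IsCMField.complexConj L) v))) : (LocalRing L v)ˣ), 1] =
          ((t : ↥(unitaryGroupOfForm (conjLocal L (IsCMField.complexConj L) v) (cmLocalForm L 3 v))) : GL (Fin 3) (LocalRing L v)) →
        ∀ x, Tr (Representation.jacquetModule
          (((chiLocalSplittingsCM L e₁ dV hdV hdV0 (toHeckeCharacter L μ) ((isOscillatorChar_toHeckeCharacter_iff μ).mpr hμ) ε).omegaLoc v).comp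
            ((localLineInl L (IsCMField.complexConj L) 3 e₁ (Matrix.diagonal dV) (JW (↥(maximalRealSubfield L)) L ε) v).comp
              ((localPiEquiv L (IsCMField.complexConj L) 3 (Matrix.diagonal dV) v).symm.toMonoidHom.comp
                (cmDatumLocalCongr L v T ha h).toMonoidHom)))
          (cmBorelTriple L 3 v) t x) =
          lineWeilCM L e₀ (kernelLineCM dV) (complexConj_kernelLineCM dV hdV) (kernelLineCM_ne_zero dV hdV0) μ hμ ε v u (Tr x) := by
  -- the permutation frame `P_σ`, `σ := e₁′⁻¹ ∘ e₁`
  obtain ⟨P, hP⟩ := exists_GL_coe_eq_permMatrix (R := ↥(maximalRealSubfield L)) (e₁'.symm.trans e₁)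
  refine lineJacquet_transport
    (((chiLocalSplittingsCM L e₁' dV hdV hdV0 (toHeckeCharacter L μ) ((isOscillatorChar_toHeckeCharacter_iff μ).mpr hμ) ε).omegaLoc v).comp
      ((localLineInl L (IsCMField.complexConj L) 3 e₁' (Matrix.diagonal dV) (JW (↥(maximalRealSubfield L)) L ε) v).comp
        ((localPiEquiv L (IsCMField.complexConj L) 3 (Matrix.diagonal dV) v).symm.toMonoidHom.comp (cmDatumLocalCongr L v T ha h).toMonoidHom)))
    (((chiLocalSplittingsCM L e₁ dV hdV hdV0 (toHeckeCharacter L μ) ((isOscillatorChar_toHeckeCharacter_iff μ).mpr hμ) ε).omegaLoc v).comp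
      ((localLineInl L (IsCMField.complexConj L) 3 e₁ (Matrix.diagonal dV) (JW (↥(maximalRealSubfield L)) L ε) v).comp
        ((localPiEquiv L (IsCMField.complexConj L) 3 (Matrix.diagonal dV) v).symm.toMonoidHom.comp (cmDatumLocalCongr L v T ha h).toMonoidHom)))
    (FrameTransport.frameOp (↥(maximalRealSubfield L)) v n' P) ?_ (cmBorelTriple L 3 v)
    (lineWeilCM L e₀ (kernelLineCM dV) (complexConj_kernelLineCM dV hdV) (kernelLineCM_ne_zero dV hdV0) μ hμ ε v)
    (lineWeilCM L e₀ (kernelLineCM dV) (complexConj_kernelLineCM dV hdV) (kernelLineCM_ne_zero dV hdV0) μ hμ ε v)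
    (LinearEquiv.refl ℂ _) (fun _ _ => rfl) _ hN'
  -- pair side: `frameOp_{P_σ} (Ω_{e₁} g f) = Ω_{e₁′} g (frameOp_{P_σ} f)` — §3 along `frameConj_{P_σ}`, then §2 `frameConj_{P_σ} ∘ localLineInl e₁ = localLineInl e₁′` at the same chart value
  intro g f
  dsimp only [FinLocalSplittings.omegaLoc]
  simp only [MonoidHom.comp_apply]
  rw [frameOp_omegaLoc_chiLocalSplittingsCM_perm L v dV hdV e₁' e₁ hdV0 ε P hP,
    frameConj_permFrame_localLineInl L (IsCMField.complexConj L) 3 e₁' e₁ v (realDiagonal_map L dV hdV).symm (TW (↥(maximalRealSubfield L)) ε) (JW_eq (↥(maximalRealSubfield L)) L ε) P hP]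

set_option synthInstance.maxHeartbeats 400000 in
set_option maxHeartbeats 8000000 in
/-- **(J4) FROM THE STANDARD ENUMERATION**: (N′) at `(dV, T, e_std)`, `e_std := Equiv.prodUnique (Fin 3) (Fin 1)` (where (C5) lands), gives (N′) at `(dV, T, e₁)` for EVERY
`e₁ : Fin 3 × Fin 1 ≃ Fin n′` — necessarily `n′ = 3` (`Fintype.card_congr e₁`), then `lineJacquet_reindex` at `(e₁, e_std)`.  This is the shape the closer's `hL` intro consumes.
[cite: BernsteinZelevinsky1976, §2.30] [cite: MoeglinVignerasWaldspurger1987, Chap. 2 II Remarque (3)] -/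
theorem lineJacquet_reindex_std {n' : ℕ} (e₁ : Fin 3 × Fin 1 ≃ Fin n') {n₀ : ℕ} (e₀ : Fin 1 × Fin 1 ≃ Fin n₀)
    (μ : Literature.NumberTheory.Automorphic.IdeleClassGroup L →ₜ* Circle) (hμ : IsConjugateSymplectic L μ)
    (T : GL (Fin 3) (LocalRing L v)) {a : LocalRing L v} (ha : IsUnit a)
    (h : formCongr (conjLocal L (IsCMField.complexConj L) v) T ((Matrix.diagonal dV).map (algebraMap L (LocalRing L v))) =
      a • (Matrix.of fun i j : Fin 3 => if i.val + j.val + 1 = 3 then (1 : L) else 0).map (algebraMap L (LocalRing L v)))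
    (hN : ∃ Tr₀ : ((cmBorelTriple L 3 v).restrict
      (((chiLocalSplittingsCM L (Equiv.prodUnique (Fin 3) (Fin 1)) dV hdV hdV0 (toHeckeCharacter L μ) ((isOscillatorChar_toHeckeCharacter_iff μ).mpr hμ) ε).omegaLoc v).comp
        ((localLineInl L (IsCMField.complexConj L) 3 (Equiv.prodUnique (Fin 3) (Fin 1)) (Matrix.diagonal dV) (JW (↥(maximalRealSubfield L)) L ε) v).comp
          ((localPiEquiv L (IsCMField.complexConj L) 3 (Matrix.diagonal dV) v).symm.toMonoidHom.comp
            (cmDatumLocalCongr L v T ha h).toMonoidHom)))).Coinvariants ≃ₗ[ℂ]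
      SchwartzBruhat (Fin n₀ → v.adicCompletion ↥(maximalRealSubfield L)),
      ∀ (u : localPi L (IsCMField.complexConj L) 1 (JW (↥(maximalRealSubfield L)) L ε) v) (t : ↥(cmBorelTriple L 3 v).M),
        glDiagonal 3 (LocalRing L v) ![1, ((localDet (IsCMField.complexConj L) v
          (isUnit_iff_ne_zero.mpr (by rw [Matrix.det_fin_one]; exact JW_apply_ne_zero (↥(maximalRealSubfield L)) L ε))
          (localPiEquiv L (IsCMField.complexConj L) 1 (JW (↥(maximalRealSubfield L)) L ε) v u) :
            ↥(normOneUnits (conjLocal L (IsCMField.complexConj L) v))) : (LocalRing L v)ˣ), 1] =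
          ((t : ↥(unitaryGroupOfForm (conjLocal L (IsCMField.complexConj L) v) (cmLocalForm L 3 v))) : GL (Fin 3) (LocalRing L v)) →
        ∀ x, Tr₀ (Representation.jacquetModule
          (((chiLocalSplittingsCM L (Equiv.prodUnique (Fin 3) (Fin 1)) dV hdV hdV0 (toHeckeCharacter L μ) ((isOscillatorChar_toHeckeCharacter_iff μ).mpr hμ) ε).omegaLoc v).comp
            ((localLineInl L (IsCMField.complexConj L) 3 (Equiv.prodUnique (Fin 3) (Fin 1)) (Matrix.diagonal dV) (JW (↥(maximalRealSubfield L)) L ε) v).comp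
              ((localPiEquiv L (IsCMField.complexConj L) 3 (Matrix.diagonal dV) v).symm.toMonoidHom.comp
                (cmDatumLocalCongr L v T ha h).toMonoidHom)))
          (cmBorelTriple L 3 v) t x) =
          lineWeilCM L e₀ (kernelLineCM dV) (complexConj_kernelLineCM dV hdV) (kernelLineCM_ne_zero dV hdV0) μ hμ ε v u (Tr₀ x)) :
    ∃ Tr : ((cmBorelTriple L 3 v).restrict
      (((chiLocalSplittingsCM L e₁ dV hdV hdV0 (toHeckeCharacter L μ) ((isOscillatorChar_toHeckeCharacter_iff μ).mpr hμ) ε).omegaLoc v).comp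
        ((localLineInl L (IsCMField.complexConj L) 3 e₁ (Matrix.diagonal dV) (JW (↥(maximalRealSubfield L)) L ε) v).comp
          ((localPiEquiv L (IsCMField.complexConj L) 3 (Matrix.diagonal dV) v).symm.toMonoidHom.comp
            (cmDatumLocalCongr L v T ha h).toMonoidHom)))).Coinvariants ≃ₗ[ℂ]
      SchwartzBruhat (Fin n₀ → v.adicCompletion ↥(maximalRealSubfield L)),
      ∀ (u : localPi L (IsCMField.complexConj L) 1 (JW (↥(maximalRealSubfield L)) L ε) v) (t : ↥(cmBorelTriple L 3 v).M),
        glDiagonal 3 (LocalRing L v) ![1, ((localDet (IsCMField.complexConj L) v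
          (isUnit_iff_ne_zero.mpr (by rw [Matrix.det_fin_one]; exact JW_apply_ne_zero (↥(maximalRealSubfield L)) L ε))
          (localPiEquiv L (IsCMField.complexConj L) 1 (JW (↥(maximalRealSubfield L)) L ε) v u) :
            ↥(normOneUnits (conjLocal L (IsCMField.complexConj L) v))) : (LocalRing L v)ˣ), 1] =
          ((t : ↥(unitaryGroupOfForm (conjLocal L (IsCMField.complexConj L) v) (cmLocalForm L 3 v))) : GL (Fin 3) (LocalRing L v)) →
        ∀ x, Tr (Representation.jacquetModule
          (((chiLocalSplittingsCM L e₁ dV hdV hdV0 (toHeckeCharacter L μ) ((isOscillatorChar_toHeckeCharacter_iff μ).mpr hμ) ε).omegaLoc v).comp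
            ((localLineInl L (IsCMField.complexConj L) 3 e₁ (Matrix.diagonal dV) (JW (↥(maximalRealSubfield L)) L ε) v).comp
              ((localPiEquiv L (IsCMField.complexConj L) 3 (Matrix.diagonal dV) v).symm.toMonoidHom.comp
                (cmDatumLocalCongr L v T ha h).toMonoidHom)))
          (cmBorelTriple L 3 v) t x) =
          lineWeilCM L e₀ (kernelLineCM dV) (complexConj_kernelLineCM dV hdV) (kernelLineCM_ne_zero dV hdV0) μ hμ ε v u (Tr x) := by
  obtain rfl : 3 = n' := by simpa using Fintype.card_congr e₁
  exact lineJacquet_reindex L v dV hdV hdV0 ε e₁ (Equiv.prodUnique (Fin 3) (Fin 1)) e₀ μ hμ T ha h hN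

end Head

end Summit.HodgeConjecture.HodgeConjecture.Cruxes.H413.F0P2oLineJacquetReindex

end
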